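import Mathlib
import Summits.Ventures.HodgeRepro.Tier4.Common.KTypeSpace
import Summits.Ventures.HodgeRepro.Tier4.Common.SettingOfData
import Summits.Ventures.HodgeRepro.Tier4.Line4.W3OfAdapted
import Summits.Ventures.HodgeRepro.Tier4.Line4.KTypeTransport

/-!
# Tier4/Line4/W3OfEquivariant — the L4 wall W3″ from basis-free per-constituent data with the scalar clauses
REPLACED by multiplicity one + the displayed left-equivariance of the test functions

Blind re-derivation cell `pub-hodge-repro`, Tier 4 «prove the step» (README §9–§10), seat t4-L4-p1 (prover, LINE L4,
gen 3).  Tree path `lean/Summits/Ventures/HodgeRepro/Tier4/Line4/W3OfEquivariant.lean`.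

WHAT IS PROVED.  `mixed_two_torus_W3_of_equivariant`: `W3OfAdapted.mixed_two_torus_W3_of_adapted` with its clauses
`ha` / `hb` («`R(f̄₁)`, `R(f₂ˇ)` act by ONE scalar on the conjugate `K`-type space of every constituent») derived from
(α) multiplicity one of the `(τ,K)`-type on every constituent (`hmult : ∀ U, IsIrrNonzero U → ∃ v, kTypeSpace … K
(span ℂ U) ≤ ℂ ∙ v` — print-facing: Ichino Lemma 7.8 at `w₀`, the newform level at the finite places) and
(β) the left-`(τ,K)`-equivariance of `f₁` and of `cj (refl f₂)` under the local tori of `T`, `T′` at every infinite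
place and under `K` (`KTypeTransport`).  The other clauses (`hfin`, `hvan`, `hadm`, `hJ`) are unchanged.  Nothing of
the wall's content is proved here; the residual is re-displayed with two of its six clauses replaced by a printed
statement plus a displayed property of the test functions.

Nothing here says anything about the status of the Hodge conjecture for CM abelian varieties, which is NOT proved
(HC_CM is NOT proved by anyone in this repository).
-/

set_option autoImplicit false

noncomputable section

namespace Summit.Ventures.HodgeRepro.Tier4.Line4

open Summit.Ventures.HodgeRepro.Tier4.Common Summit.Ventures.HodgeRepro.Tier4.Line1 MeasureTheory NumberField
open scoped ComplexConjugate

section Equivariant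

variable {k : Type} [Field k] [NumberField k] (W : PlaneData k) [MeasurableSpace (GA W)] [BorelSpace (GA W)]
  (R : RTFData W) (μ : Measure (GA W)) [μ.IsHaarMeasure] [R.μT.IsHaarMeasure] [R.μT'.IsHaarMeasure]
  (DG : Set (GA W)) (fdG : IsFundamentalDomain (rationalPoints W) DG μ) (compG : IsCompact (closure DG))
  (compT : IsCompact (closure R.DT)) (compT' : IsCompact (closure R.DT'))

/-- **W3″ from multiplicity one + left-equivariant test functions** (the clauses `ha`/`hb` of
`mixed_two_torus_W3_of_adapted` replaced by `hmult` + the equivariance of `f₁` and `cj (refl f₂)`). -/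
theorem mixed_two_torus_W3_of_equivariant (hc : Continuous R.chi) (hu : ∀ a, ‖R.chi a‖ = 1)
    (hc' : Continuous R.chi') (hunit' : ∀ t, ‖R.chi' t‖ = 1)
    (q : QuadData k) (g g' : Matrix (Fin 4) (Fin 4) k) (w₀ : InfinitePlace k)
    (eP eM eP' eM' : InfinitePlace k → ℤ)
    (K : Subgroup (GA W)) (hK : IsCompactOpenIn W (finitePart W) K)
    (hfin : ∀ U : Set (GA W → ℂ), (Setting.ofAdelicData W R μ DG fdG compG compT compT').IsInvariantSubspace U →
      FiniteDimensional ℂ (kTypeSpace W q g g' eP eM eP' eM' K (Submodule.span ℂ U)))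
    (hmult : ∀ U : Set (GA W → ℂ), (Setting.ofAdelicData W R μ DG fdG compG compT compT').IsIrrNonzero U →
      ∃ v : GA W → ℂ, kTypeSpace W q g g' eP eM eP' eM' K (Submodule.span ℂ U) ≤ Submodule.span ℂ {v})
    {f₁ f₂ : GA W → ℂ} (h₁ : IsTestFn W f₁) (h₂ : IsTestFn W f₂)
    (h₁T : ∀ (w : InfinitePlace k) (κ : GA W), κ ∈ localTorusAt W w → ∀ y,
      f₁ (κ⁻¹ * y) = weightAt W q w 0 κ ^ eP w * weightAt W q w 1 κ ^ eM w * f₁ y)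
    (h₁T' : ∀ (w : InfinitePlace k) (κ : GA W), κ ∈ localTorusAt' W w → ∀ y,
      f₁ (κ⁻¹ * y) = weightAt' W q w g g' 0 κ ^ eP' w * weightAt' W q w g g' 1 κ ^ eM' w * f₁ y)
    (h₁K : ∀ κ ∈ K, ∀ y, f₁ (κ⁻¹ * y) = f₁ y)
    (h₂T : ∀ (w : InfinitePlace k) (κ : GA W), κ ∈ localTorusAt W w → ∀ y,
      RTF.cj (RTF.refl f₂) (κ⁻¹ * y) =
        weightAt W q w 0 κ ^ eP w * weightAt W q w 1 κ ^ eM w * RTF.cj (RTF.refl f₂) y)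
    (h₂T' : ∀ (w : InfinitePlace k) (κ : GA W), κ ∈ localTorusAt' W w → ∀ y,
      RTF.cj (RTF.refl f₂) (κ⁻¹ * y) =
        weightAt' W q w g g' 0 κ ^ eP' w * weightAt' W q w g g' 1 κ ^ eM' w * RTF.cj (RTF.refl f₂) y)
    (h₂K : ∀ κ ∈ K, ∀ y, RTF.cj (RTF.refl f₂) (κ⁻¹ * y) = RTF.cj (RTF.refl f₂) y)
    (hvan : ∀ U : Set (GA W → ℂ), (Setting.ofAdelicData W R μ DG fdG compG compT compT').IsIrrNonzero U →
      ∀ ψ ∈ U, (∀ w ∈ kTypeSpace W q g g' eP eM eP' eM' K (Submodule.span ℂ U),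
        (Setting.ofAdelicData W R μ DG fdG compG compT compT').inner ψ w = 0) →
        rightRegular W μ (RTF.cj f₁) (fun x => conj (ψ x)) = fun _ => 0)
    (hadm : ∀ U : Set (GA W → ℂ), (Setting.ofAdelicData W R μ DG fdG compG compT compT').IsIrrNonzero U →
      ∀ a : ℂ, a ≠ 0 →
      (∃ ψ ∈ kTypeSpace W q g g' eP eM eP' eM' K (Submodule.span ℂ U), ψ ≠ 0 ∧
        rightRegular W μ (RTF.cj f₁) (fun x => conj (ψ x)) = fun x => a * conj (ψ x)) →
      IsAdmissibleS W (Setting.ofAdelicData W R μ DG fdG compG compT compT') q g g' w₀ eP eM eP' eM'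
        (Submodule.span ℂ U))
    (hJ : R.Jc ((Setting.ofAdelicData W R μ DG fdG compG compT compT').conv f₁ f₂) ≠ 0) :
    ∃ V₀ : Submodule ℂ (GA W → ℂ),
      IsAdmissibleS W (Setting.ofAdelicData W R μ DG fdG compG compT compT') q g g' w₀ eP eM eP' eM' V₀ ∧
      ∃ K₀ : Subgroup (GA W), IsCompactOpenIn W (finitePart W) K₀ ∧
        FiniteDimensional ℂ (kTypeSpace W q g g' eP eM eP' eM' K₀ V₀) ∧
        ∃ f : GA W → ℂ, IsRieszVectorOn R μ DG (kTypeSpace W q g g' eP eM eP' eM' K₀ V₀) f ∧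
          periodLin W R.μT R.DT R.chi (restrictTo W (torusT W) f) ≠ 0 := by
  set S := Setting.ofAdelicData W R μ DG fdG compG compT compT' with hS
  -- the span of a non-zero irreducible invariant subspace is an invariant subspace
  have hspanInv : ∀ U : Set (GA W → ℂ), S.IsIrrNonzero U →
      S.IsInvariantSubspace ((Submodule.span ℂ U : Submodule ℂ (GA W → ℂ)) : Set (GA W → ℂ)) := by
    intro U hU
    obtain ⟨ψ, hψ, -⟩ := hU.2.2
    rw [coe_span_eq_of_isInvariantSubspace S hU.1 ⟨ψ, hψ⟩]
    exact hU.1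
  have h₂' : IsTestFn W (RTF.cj (RTF.refl f₂)) :=
    ⟨(RTF.IsTest.cj (RTF.IsTest.refl ⟨h₂.1, h₂.2⟩)).cont, (RTF.IsTest.cj (RTF.IsTest.refl ⟨h₂.1, h₂.2⟩)).compact⟩
  refine mixed_two_torus_W3_of_adapted W R μ DG fdG compG compT compT' hc hu hc' hunit' q g g' w₀ eP eM eP' eM' K hK
    hfin h₁ h₂ ?_ ?_ hvan hadm hJ
  · intro U hU
    exact exists_scalar_conj_of_le_span_singleton W μ R DG fdG compG compT compT' q g g' eP eM eP' eM' K
      (Submodule.span ℂ U) (hspanInv U hU) h₁ h₁T h₁T' h₁K (hmult U hU)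
  · intro U hU
    have := exists_scalar_conj_of_le_span_singleton W μ R DG fdG compG compT compT' q g g' eP eM eP' eM' K
      (Submodule.span ℂ U) (hspanInv U hU) h₂' h₂T h₂T' h₂K (hmult U hU)
    rw [cj_cj] at this
    exact this

end Equivariant

end Summit.Ventures.HodgeRepro.Tier4.Line4

end
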